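import Summits.Ventures.PercRepro.Night2NoLoads

/-!
# night-2: NO NEAR-FAT CLOSURE ⇒ h21's cell `(2, 1)` whenever every thin member misses `≥ 4` points (gen 39)

With every target unloaded (Night2NoLoads) every target of the top four levels has `vCap = 1` and every hitting target
`vCap ≥ 11/18` at EVERY level (`free_targets_subset_and_income`, income `freeIncome N := Σ_{i=1}^{N} [N ≤ i + 3 ?
C(N, i) · 3/C(i+5, 4) : (11/18) (C(N, i) − 5 C(N−2, i))⁺ · 3/C(i+5, 4)]`, which is `1.51, 1.42, 1.31, 1.20, 1.11, 1.21, 1.34, 1.67`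
at `N = 4 … 11`): **`basis_pair_fair_of_four_thin`**, **`localShadowHall_two_one_of_four_thin`** — h21's cell `(2, 1)` for every
`G` in which every thin member misses at least four points.  THE NON-FAT CASE OF (FAIR) IS THEREBY REDUCED TO THE NEAR-FAT CASE:
some thin member misses exactly three points, `11 ≤ |G| ≤ 16`.  Paper: proofs/NIGHT-2-g39.md §8.
-/

namespace PercRepro.Shadow

open PercRepro.ThmH PercRepro.PerFlat

variable {α : Type*} [DecidableEq α] {M : Matroid α} [M.Finite] {G : Finset α}

/-- The load-free income: every level, the top four at full capacity, the hitting count elsewhere. -/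
noncomputable def freeIncome (N : ℕ) : ℚ :=
  ∑ i ∈ Finset.range (N + 1), if 1 ≤ i then
    (if N ≤ i + 3 then ((N.choose i : ℕ) : ℚ) * 3 / (((i + 5).choose 4 : ℕ) : ℚ)
      else 11 / 18 * max 0 (((N.choose i : ℕ) : ℚ) - 5 * (((N - 2).choose i : ℕ) : ℚ)) * 3 /
        (((i + 5).choose 4 : ℕ) : ℚ))
  else 0

omit [DecidableEq α] in
/-- **The abstract regrouping of the load-free family** (every level `≥ 1`). -/
theorem freeIncome_le_sum_filter (W : Finset α) (P : Finset α → Prop) [DecidablePred P]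
    (hcount : ∀ i, 1 ≤ i → ¬ W.card ≤ i + 3 →
      ((W.card.choose i : ℕ) : ℚ) - 5 * (((W.card - 2).choose i : ℕ) : ℚ) ≤
        (((W.powersetCard i).filter P).card : ℚ)) :
    freeIncome W.card ≤
      ∑ Y ∈ W.powerset.filter (fun Y => 1 ≤ Y.card ∧ (W.card ≤ Y.card + 3 ∨ P Y)),
        (if W.card ≤ Y.card + 3 then (1 : ℚ) else 11 / 18) * 3 / (((Y.card + 5).choose 4 : ℕ) : ℚ) := by
  set fam : Finset (Finset α) := W.powerset.filter (fun Y => 1 ≤ Y.card ∧ (W.card ≤ Y.card + 3 ∨ P Y))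
    with hfam
  have hmaps : ∀ Y ∈ fam, Y.card ∈ Finset.range (W.card + 1) := fun Y hY =>
    Finset.mem_range.2 (Nat.lt_succ_of_le (Finset.card_le_card
      (Finset.mem_powerset.1 (Finset.mem_filter.1 hY).1)))
  have hfiber := Finset.sum_fiberwise_of_maps_to hmaps
    (fun Y => (if W.card ≤ Y.card + 3 then (1 : ℚ) else 11 / 18) * 3 / (((Y.card + 5).choose 4 : ℕ) : ℚ))
  rw [← hfiber]
  unfold freeIncome
  apply Finset.sum_le_sum
  intro i _
  have hfib : ∑ Y ∈ fam.filter (fun Y => Y.card = i),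
      (if W.card ≤ Y.card + 3 then (1 : ℚ) else 11 / 18) * 3 / (((Y.card + 5).choose 4 : ℕ) : ℚ) =
      ((fam.filter (fun Y => Y.card = i)).card : ℚ) *
        ((if W.card ≤ i + 3 then (1 : ℚ) else 11 / 18) * 3 / (((i + 5).choose 4 : ℕ) : ℚ)) := by
    rw [Finset.sum_congr rfl (fun Y hY => by rw [(Finset.mem_filter.1 hY).2])]
    rw [Finset.sum_const, nsmul_eq_mul]
  rw [hfib]
  split_ifs with h1i htop
  · have hsub : W.powersetCard i ⊆ fam.filter (fun Y => Y.card = i) := by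
      intro Y hY
      rw [Finset.mem_powersetCard] at hY
      rw [Finset.mem_filter, hfam, Finset.mem_filter, Finset.mem_powerset]
      exact ⟨⟨hY.1, by omega, Or.inl (by omega)⟩, hY.2⟩
    have hcard : ((W.card.choose i : ℕ) : ℚ) ≤ ((fam.filter (fun Y => Y.card = i)).card : ℚ) := by
      rw [← Finset.card_powersetCard]
      exact_mod_cast Finset.card_le_card hsub
    have hC : (0 : ℚ) ≤ 3 / (((i + 5).choose 4 : ℕ) : ℚ) := by positivity
    calc ((W.card.choose i : ℕ) : ℚ) * 3 / (((i + 5).choose 4 : ℕ) : ℚ)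
        = ((W.card.choose i : ℕ) : ℚ) * (3 / (((i + 5).choose 4 : ℕ) : ℚ)) := by ring
      _ ≤ ((fam.filter (fun Y => Y.card = i)).card : ℚ) * (3 / (((i + 5).choose 4 : ℕ) : ℚ)) :=
          mul_le_mul_of_nonneg_right hcard hC
      _ = ((fam.filter (fun Y => Y.card = i)).card : ℚ) * (1 * 3 / (((i + 5).choose 4 : ℕ) : ℚ)) := by ring
  · have hsub : (W.powersetCard i).filter P ⊆ fam.filter (fun Y => Y.card = i) := by
      intro Y hY
      rw [Finset.mem_filter, Finset.mem_powersetCard] at hY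
      obtain ⟨⟨hYW, hYi⟩, hP⟩ := hY
      rw [Finset.mem_filter, hfam, Finset.mem_filter, Finset.mem_powerset]
      exact ⟨⟨hYW, by omega, Or.inr hP⟩, hYi⟩
    have hcard : (((W.powersetCard i).filter P).card : ℚ) ≤ ((fam.filter (fun Y => Y.card = i)).card : ℚ) := by
      exact_mod_cast Finset.card_le_card hsub
    have hC : (0 : ℚ) ≤ 11 / 18 * 3 / (((i + 5).choose 4 : ℕ) : ℚ) := by positivity
    have hmax : max 0 (((W.card.choose i : ℕ) : ℚ) - 5 * (((W.card - 2).choose i : ℕ) : ℚ)) ≤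
        ((fam.filter (fun Y => Y.card = i)).card : ℚ) :=
      max_le (by positivity) (le_trans (hcount i h1i htop) hcard)
    calc 11 / 18 * max 0 (((W.card.choose i : ℕ) : ℚ) - 5 * (((W.card - 2).choose i : ℕ) : ℚ)) * 3 /
          (((i + 5).choose 4 : ℕ) : ℚ)
        = max 0 (((W.card.choose i : ℕ) : ℚ) - 5 * (((W.card - 2).choose i : ℕ) : ℚ)) *
            (11 / 18 * 3 / (((i + 5).choose 4 : ℕ) : ℚ)) := by ring
      _ ≤ ((fam.filter (fun Y => Y.card = i)).card : ℚ) * (11 / 18 * 3 / (((i + 5).choose 4 : ℕ) : ℚ)) :=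
          mul_le_mul_of_nonneg_right hmax hC
  all_goals positivity

/-- **The per-target bound of the load-free family**: an unloaded target has `vCap = 1` at the top four levels and
`vCap ≥ 11/18` when hitting. -/
theorem free_term (hG : G ∈ flatsQ M (5 + 1)) (hd : (gr M \ G).card = 2)
    (hk : kColoops M G = 1) (hnf : fatClosures M 5 G 2 = ∅) {B : Finset α}
    (hB : B ∈ thinMembers M 5 G) (hnP : ¬ bigP M G B) {z : α} (hz : z ∈ G \ clF M B)
    (hl0 : loss M 5 G B z ≠ 0) {Y : Finset α} (hYW : Y ⊆ G \ insert z B) (hne : Y.Nonempty)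
    (hdl : dload M 5 G (bigP M G) (dshGT2 M 5 G) (insert z B ∪ Y) = 0)
    (hYtop : (G \ insert z B).card ≤ Y.card + 3 ∨
      ∀ w ∈ (insert z B \ coloops M G).filter (fun w => faceOk M G (insert z B) w),
        ¬ Y ⊆ clF M ((insert z B).erase w)) :
    (if (G \ insert z B).card ≤ Y.card + 3 then (1 : ℚ) else 11 / 18) * 3 /
      (((Y.card + 5).choose 4 : ℕ) : ℚ) ≤ vCap M G (insert z B ∪ Y) / faceSum M G (insert z B ∪ Y) := by
  have hQG : insert z B ⊆ G :=
    Finset.insert_subset (Finset.mem_sdiff.1 hz).1 (subset_G_of_mem_thinMembers hB)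
  have hT : insert z B ∪ Y ∈ tgtSets M 5 G B z := by
    rw [tgtSets_eq_image hG (mem_thinMembers.1 hB).1 hz, Finset.mem_image]
    exact ⟨Y, Finset.mem_filter.2 ⟨Finset.mem_powerset.2 hYW, hne⟩, rfl⟩
  have hTG : insert z B ∪ Y ⊆ G := Finset.union_subset hQG (hYW.trans Finset.sdiff_subset)
  have hpos := faceSum_pos_of_mem_tgtSets hG hd hk hB hnP hz hl0 hT
  have hfs := faceSum_le_third_mul_choose hG hd hk hnf hTG
  rw [card_union_sdiff_coloops_eq hG hd hk hB hnP hz hYW, add_comm] at hfs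
  have hC : (0 : ℚ) < (((Y.card + 5).choose 4 : ℕ) : ℚ) := by
    exact_mod_cast Nat.choose_pos (by omega)
  have hv : (if (G \ insert z B).card ≤ Y.card + 3 then (1 : ℚ) else 11 / 18) ≤
      vCap M G (insert z B ∪ Y) := by
    split_ifs with htop
    · have hcomp : G \ (insert z B ∪ Y) = (G \ insert z B) \ Y := by
        ext x
        simp only [Finset.mem_sdiff, Finset.mem_union, not_or]
        tauto
      have hcard : ((G \ insert z B) \ Y).card ≤ 3 := by
        have h1 := Finset.card_sdiff_add_card_inter (G \ insert z B) Y
        rw [Finset.inter_eq_right.2 hYW] at h1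
        omega
      have hrk : rkN M (G \ (insert z B ∪ Y)) ≤ 3 := by
        rw [hcomp]
        exact le_trans (rkN_le_card _) hcard
      rw [vCap_eq_one_of_rkN_sdiff_le_three hd hdl hrk]
    · rcases hYtop with h | hhit
      · exact absurd h htop
      · exact vCap_ge_of_hitting hG hd hk hB hnP hz hYW hne hdl hhit
  rw [div_le_div_iff₀ hC hpos]
  have hv0 : (0 : ℚ) ≤ (if (G \ insert z B).card ≤ Y.card + 3 then (1 : ℚ) else 11 / 18) := by
    split_ifs <;> norm_num
  nlinarith

/-- **The load-free family**: when every target is unloaded, the top-or-hitting targets of every level form a sub-family of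
income at least `freeIncome N`. -/
theorem free_targets_subset_and_income (hG : G ∈ flatsQ M (5 + 1)) (hd : (gr M \ G).card = 2)
    (hk : kColoops M G = 1) (hnf : fatClosures M 5 G 2 = ∅) {B : Finset α}
    (hB : B ∈ thinMembers M 5 G) (hnP : ¬ bigP M G B) {z : α} (hz : z ∈ G \ clF M B)
    (hl0 : loss M 5 G B z ≠ 0)
    (hdl : ∀ Y ⊆ G \ insert z B, Y.Nonempty → dload M 5 G (bigP M G) (dshGT2 M 5 G) (insert z B ∪ Y) = 0) :
    (((G \ insert z B).powerset.filter (fun Y => 1 ≤ Y.card ∧ ((G \ insert z B).card ≤ Y.card + 3 ∨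
        ∀ w ∈ (insert z B \ coloops M G).filter (fun w => faceOk M G (insert z B) w),
          ¬ Y ⊆ clF M ((insert z B).erase w)))).image (fun Y => insert z B ∪ Y)) ⊆ tgtSets M 5 G B z ∧
      freeIncome (G \ insert z B).card ≤
        ∑ T ∈ ((G \ insert z B).powerset.filter (fun Y => 1 ≤ Y.card ∧ ((G \ insert z B).card ≤ Y.card + 3 ∨
          ∀ w ∈ (insert z B \ coloops M G).filter (fun w => faceOk M G (insert z B) w),
            ¬ Y ⊆ clF M ((insert z B).erase w)))).image (fun Y => insert z B ∪ Y),
          vCap M G T / faceSum M G T := by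
  set fam : Finset (Finset α) := (G \ insert z B).powerset.filter (fun Y => 1 ≤ Y.card ∧
    ((G \ insert z B).card ≤ Y.card + 3 ∨
      ∀ w ∈ (insert z B \ coloops M G).filter (fun w => faceOk M G (insert z B) w),
        ¬ Y ⊆ clF M ((insert z B).erase w))) with hfam
  set 𝒯 : Finset (Finset α) := fam.image (fun Y => insert z B ∪ Y) with h𝒯
  have hmem : ∀ Y ∈ fam, Y ⊆ G \ insert z B ∧ 1 ≤ Y.card ∧ ((G \ insert z B).card ≤ Y.card + 3 ∨
      ∀ w ∈ (insert z B \ coloops M G).filter (fun w => faceOk M G (insert z B) w),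
        ¬ Y ⊆ clF M ((insert z B).erase w)) := by
    intro Y hY
    rw [hfam, Finset.mem_filter, Finset.mem_powerset] at hY
    exact ⟨hY.1, hY.2.1, hY.2.2⟩
  have h𝒯sub : 𝒯 ⊆ tgtSets M 5 G B z := by
    intro T hT
    rw [h𝒯, Finset.mem_image] at hT
    obtain ⟨Y, hY, rfl⟩ := hT
    obtain ⟨hYW, hYc, -⟩ := hmem Y hY
    rw [tgtSets_eq_image hG (mem_thinMembers.1 hB).1 hz, Finset.mem_image]
    refine ⟨Y, Finset.mem_filter.2 ⟨Finset.mem_powerset.2 hYW, ?_⟩, rfl⟩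
    rw [← Finset.card_pos]
    omega
  have hinj : Set.InjOn (fun Y => insert z B ∪ Y) (fam : Set (Finset α)) := by
    intro Y₁ hY₁ Y₂ hY₂ heq
    rw [Finset.mem_coe] at hY₁ hY₂
    have key : ∀ Y ∈ fam, (insert z B ∪ Y) ∩ (G \ insert z B) = Y := by
      intro Y hY
      ext x
      rw [Finset.mem_inter, Finset.mem_union]
      constructor
      · rintro ⟨hx | hx, hxW⟩
        · exact absurd hx (Finset.mem_sdiff.1 hxW).2
        · exact hx
      · intro hx
        exact ⟨Or.inr hx, (hmem Y hY).1 hx⟩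
    have h1 := key Y₁ hY₁
    have h2 := key Y₂ hY₂
    simp only at heq
    rw [← h1, ← h2, heq]
  have hterm : ∀ Y ∈ fam, (if (G \ insert z B).card ≤ Y.card + 3 then (1 : ℚ) else 11 / 18) * 3 /
      (((Y.card + 5).choose 4 : ℕ) : ℚ) ≤ vCap M G (insert z B ∪ Y) / faceSum M G (insert z B ∪ Y) := by
    intro Y hY
    obtain ⟨hYW, hYc, hYtop⟩ := hmem Y hY
    have hne : Y.Nonempty := by
      rw [← Finset.card_pos]
      omega
    exact free_term hG hd hk hnf hB hnP hz hl0 hYW hne (hdl Y hYW hne) hYtop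
  have hsum𝒯 : ∑ Y ∈ fam, (if (G \ insert z B).card ≤ Y.card + 3 then (1 : ℚ) else 11 / 18) * 3 /
      (((Y.card + 5).choose 4 : ℕ) : ℚ) ≤ ∑ T ∈ 𝒯, vCap M G T / faceSum M G T := by
    rw [h𝒯, Finset.sum_image hinj]
    exact Finset.sum_le_sum hterm
  refine ⟨h𝒯sub, le_trans ?_ hsum𝒯⟩
  exact freeIncome_le_sum_filter (G \ insert z B) _
    (fun i _ _ => card_filter_hitting_ge hG hd hk hnf hB hnP hz i)

/-- **THE LOAD-FREE THEOREM**: every target unloaded and `1 ≤ freeIncome |W|` ⇒ fair. -/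
theorem basis_pair_fair_of_no_loads (hG : G ∈ flatsQ M (5 + 1)) (hd : (gr M \ G).card = 2)
    (hk : kColoops M G = 1) (hs : ∀ e ∈ gr M, ∀ f ∈ gr M, e ≠ f → rkN M {e, f} = 2)
    (hl : ∀ e ∈ gr M, M.Indep {e}) (hnf : fatClosures M 5 G 2 = ∅) {B : Finset α}
    (hB : B ∈ thinMembers M 5 G) (hnP : ¬ bigP M G B) {z : α} (hz : z ∈ G \ clF M B)
    (hl0 : loss M 5 G B z ≠ 0)
    (hdl : ∀ Y ⊆ G \ insert z B, Y.Nonempty → dload M 5 G (bigP M G) (dshGT2 M 5 G) (insert z B ∪ Y) = 0)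
    (hsum : 1 ≤ freeIncome (G \ insert z B).card) :
    loss M 5 G B z ≤ rhoL M 5 G B z * lossIncomeH M 5 G (bigP M G) (dshGT2 M 5 G) B z := by
  have hfat : (fatClosures M 5 G 2).card ≤ 1 := by
    rw [hnf, Finset.card_empty]
    exact zero_le_one
  obtain ⟨hsub, hinc⟩ := free_targets_subset_and_income hG hd hk hnf hB hnP hz hl0 hdl
  exact basis_pair_fair_of_vCap_face_sum_subfamily hG hd hk hs hl hfat hB hnP hz hl0 hsub (hsum.trans hinc)

/-- `freeIncome N ≥ 1` for every `4 ≤ N ≤ 11` (`1.51, 1.42, 1.31, 1.20, 1.11, 1.21, 1.34, 1.67`). -/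
theorem one_le_freeIncome_of_le {N : ℕ} (h4 : 4 ≤ N) (h11 : N ≤ 11) : 1 ≤ freeIncome N := by
  interval_cases N <;>
    (unfold freeIncome
     simp only [Finset.sum_range_succ, Finset.sum_range_zero]
     norm_num [Nat.choose, max_def])

/-- **Every thin member misses `≥ 4` points ⇒ every lossy basis pair is fair.** -/
theorem basis_pair_fair_of_four_thin (hG : G ∈ flatsQ M (5 + 1)) (hd : (gr M \ G).card = 2)
    (hk : kColoops M G = 1) (hs : ∀ e ∈ gr M, ∀ f ∈ gr M, e ≠ f → rkN M {e, f} = 2)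
    (hl : ∀ e ∈ gr M, M.Indep {e}) (h4 : ∀ B ∈ thinMembers M 5 G, 4 ≤ (G \ clF M B).card) {B : Finset α}
    (hB : B ∈ thinMembers M 5 G) (hnP : ¬ bigP M G B) {z : α} (hz : z ∈ G \ clF M B)
    (hl0 : loss M 5 G B z ≠ 0) :
    loss M 5 G B z ≤ rhoL M 5 G B z * lossIncomeH M 5 G (bigP M G) (dshGT2 M 5 G) B z := by
  have hnf := fatClosures_eq_empty_of_four_thin h4
  rcases Nat.lt_or_ge (G \ insert z B).card 12 with hlt | hge
  · apply basis_pair_fair_of_no_loads hG hd hk hs hl hnf hB hnP hz hl0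
      (fun Y _ _ => dload_eq_zero_of_four_thin hG hd hk hs hl h4 _)
    exact one_le_freeIncome_of_le (four_le_card_sdiff_insert hG hd hB hz) (by omega)
  · exact basis_pair_fair_of_twelve hG hd hk hs hl hnf hB hnP hz hl0 hge

/-- **h21's cell `(2, 1)` whenever every thin member misses `≥ 4` points** (every size; no fat closure exists then). -/
theorem localShadowHall_two_one_of_four_thin (hG : G ∈ flatsQ M (5 + 1)) (hd : (gr M \ G).card = 2)
    (hk : kColoops M G = 1) (hs : ∀ e ∈ gr M, ∀ f ∈ gr M, e ≠ f → rkN M {e, f} = 2)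
    (hl : ∀ e ∈ gr M, M.Indep {e}) (h4 : ∀ B ∈ thinMembers M 5 G, 4 ≤ (G \ clF M B).card) :
    LocalShadowHall M 5 G := by
  have hnf := fatClosures_eq_empty_of_four_thin h4
  have hfat : (fatClosures M 5 G 2).card ≤ 1 := by
    rw [hnf, Finset.card_empty]
    exact zero_le_one
  apply localShadowHall_of_gt2_of_basis_fair hG hd hk hs hl hfat
  intro B hB hnP z hz
  by_cases hl0 : loss M 5 G B z = 0
  · rw [hl0]
    have hd' : (gr M \ G).card ≤ 5 := by omega
    have h1 : 0 ≤ rhoL M 5 G B z := by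
      unfold rhoL
      rw [hl0]
      simp
    have h2 : 0 ≤ lossIncomeH M 5 G (bigP M G) (dshGT2 M 5 G) B z :=
      lossIncomeH_nonneg hG hd' (column_side_gt2 hG hd hk hs hl hfat) B z
    positivity
  · exact basis_pair_fair_of_four_thin hG hd hk hs hl h4 hB hnP hz hl0

end PercRepro.Shadow
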